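import Mathlib
import Literature.AlgebraicGeometry.Resolution.PolygonInvariantsIndexed
import HarnessLib

/-!
# Weighted order ideals under the coordinate changes of the polyhedron game — ARBITRARY embedding dimension

Topic: `Literature/AlgebraicGeometry/Resolution`. Dimension-general form of `WeightedIdealCoordinateChanges.lean` and of the coordinate-change
half of `VertexDissolution.lean` (`c : Fin 3 → R`): a brick of the generalisation `Fin 3 → Fin (r+2)` of the tree's expansion-free rendering of
Hironaka's characteristic polyhedra (memo `run/shared/lean/pub/res-hironaka/L/res-L1-w42-stub-3/KEYCLAIM-PORT-PLAN.md` §4–§6). The coordinate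
changes of Cossart–Jannsen–Saito, LNM 2270, Ch. 8 and §13 act on a regular system of parameters `c = (y₁, …, y_r, u₁, u₂)`: the **dissolution
of a vertex** `y_j ↦ y_j + λ_j u₁^{a} u₂^{b}` for ALL `j` at once (Def. 8.2 (3) / Thm. 8.16: «change `y` to `z = y + λ u^v`»; Cossart–Piltant
2008 p. 11) and the **shear** `u₂ ↦ u₂ + λ u₁` (Lemma 13.6: `ũ₂ = u₂ − φ u₁`; Cossart–Piltant p. 12). PROVED (ns `WeightedOrder`, for the
weighted order ideals `F^{(w)}_ρ(c) = weightedOrderIdeal c w ρ` of `WeightedOrderIdealsIndexed`; no facts):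

* generic (`c c′ : σ → R`): `prod_pow_mem_weightedOrderIdeal` (`∏ x_i^{k_i} ∈ F_{Σ k_i a_i}` when `x_i ∈ F_{a_i}`),
  `cmonom_mem_weightedOrderIdeal_of_forall_apply_mem`, **`weightedOrderIdeal_le_of_forall_apply_mem`** (`c′_i ∈ F_{w_i}(c)` for all `i`
  ⇒ `F_ρ(c′) ⊆ F_ρ(c)` for all `ρ`), `weightedOrderIdeal_eq_of_forall_apply_mem`;
* the y-block dissolution `yShift c t = (y + t, u₁, u₂)` (`t : Fin r → R`): components, `yShift_yShift_neg`, `uMonom c lam a b = λ u₁^a u₂^b`,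
  `uMonom_yShift`, `uMonom_mem_weightedOrderIdeal` (`a w_{u₁} + b w_{u₂} ≥ ρ ⇒ λ u₁^a u₂^b ∈ F_ρ`), **`weightedOrderIdeal_yShift`**
  (`F_ρ(y + t, u) = F_ρ(y, u)` when `t_j ∈ F_{w_{y_j}}` w.r.t. both systems, e.g. `t_j = λ_j u₁^a u₂^b` with `a w_{u₁} + b w_{u₂} ≥ w_{y_j}`:
  `weightedOrderIdeal_yShift_uMonom`), `span_range_yShift` (`(y + t, u)` generates `𝔪` when the `t_j ∈ (u₁, u₂)`);
* the shear `u2Shear c lam = (y, u₁, u₂ + λ u₁)`: components, **`weightedOrderIdeal_u2Shear`** (`F_ρ` unchanged when `w_{u₂} ≤ w_{u₁}`),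
  `span_range_u2Shear`.

Sources: V. Cossart, U. Jannsen, S. Saito, LNM **2270** (2020), Def. 8.2 (3), Thm. 8.16, Lemma 13.6 [`CossartJannsenSaito2020`]; V. Cossart,
O. Piltant, J. Algebra 320 (2008), proof of Lemma 4.5, pp. 11–12 [`CossartPiltant2008`]; H. Hironaka, J. Math. Kyoto Univ. 7 (1967), §3
[`Hironaka1967`]. No named facts; no instance, notation or attribute.
-/

noncomputable section

open IsLocalRing MvPolynomial

namespace Literature.AlgebraicGeometry.Resolution

namespace WeightedOrder

universe u v

variable {R : Type u} [CommRing R] {σ : Type v}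

/-! ## Generic comparison of the weighted order ideals of two families -/

/-- `x_i ∈ F_{a_i}` for `i ∈ s` ⇒ `∏_{i ∈ s} x_i^{k_i} ∈ F_{Σ_{i ∈ s} k_i a_i}`. [cite: CossartJannsenSaito2020, Def. 7.2 (1)] -/
theorem prod_pow_mem_weightedOrderIdeal (c : σ → R) (w : σ → ℕ) {ι : Type*} (s : Finset ι) {x : ι → R} {a : ι → ℕ} (k : ι → ℕ)
    (h : ∀ i ∈ s, x i ∈ weightedOrderIdeal c w (a i)) : ∏ i ∈ s, x i ^ k i ∈ weightedOrderIdeal c w (∑ i ∈ s, k i * a i) := by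
  classical
  induction s using Finset.induction_on with
  | empty => simp [weightedOrderIdeal_zero]
  | insert i s hi ih =>
    rw [Finset.prod_insert hi, Finset.sum_insert hi]
    have h1 : x i ^ k i ∈ weightedOrderIdeal c w (k i * a i) :=
      weightedOrderIdeal_pow_le c w _ _ (Ideal.pow_mem_pow (h i (Finset.mem_insert_self _ _)) _)
    have h2 := ih fun j hj => h j (Finset.mem_insert_of_mem hj)
    exact weightedOrderIdeal_mul_le c w _ _ (Ideal.mul_mem_mul h1 h2)

/-- If `c′_i ∈ F_{w_i}(c)` for every `i`, then every monomial `c′^e` lies in `F_{⟨w, e⟩}(c)`. [cite: CossartJannsenSaito2020, Def. 7.2 (1)] -/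
theorem cmonom_mem_weightedOrderIdeal_of_forall_apply_mem (c c' : σ → R) (w : σ → ℕ) (h : ∀ i, c' i ∈ weightedOrderIdeal c w (w i))
    (e : σ →₀ ℕ) : cmonom c' e ∈ weightedOrderIdeal c w (Finsupp.weight w e) := by
  have := prod_pow_mem_weightedOrderIdeal c w e.support (x := c') (a := w) e fun i _ => h i
  rw [Finsupp.weight_apply, Finsupp.sum]
  simpa [cmonom, Finsupp.prod, smul_eq_mul] using this

/-- **`c′_i ∈ F_{w_i}(c)` for all `i` ⇒ `F_ρ(c′) ⊆ F_ρ(c)` for all `ρ`.** [cite: CossartJannsenSaito2020, Def. 7.2 (1)] -/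
theorem weightedOrderIdeal_le_of_forall_apply_mem (c c' : σ → R) (w : σ → ℕ) (h : ∀ i, c' i ∈ weightedOrderIdeal c w (w i)) (ρ : ℕ) :
    weightedOrderIdeal c' w ρ ≤ weightedOrderIdeal c w ρ := by
  rw [weightedOrderIdeal, Ideal.span_le]
  rintro _ ⟨e, he, rfl⟩
  exact weightedOrderIdeal_antitone c w he (cmonom_mem_weightedOrderIdeal_of_forall_apply_mem c c' w h e)

/-- Two families each of whose members has the expected weight w.r.t. the other have the same weighted order ideals.
[cite: CossartJannsenSaito2020, Def. 7.2 (1)] -/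
theorem weightedOrderIdeal_eq_of_forall_apply_mem (c c' : σ → R) (w : σ → ℕ) (h : ∀ i, c' i ∈ weightedOrderIdeal c w (w i))
    (h' : ∀ i, c i ∈ weightedOrderIdeal c' w (w i)) (ρ : ℕ) : weightedOrderIdeal c' w ρ = weightedOrderIdeal c w ρ :=
  le_antisymm (weightedOrderIdeal_le_of_forall_apply_mem c c' w h ρ) (weightedOrderIdeal_le_of_forall_apply_mem c' c w h' ρ)

/-! ## The dissolution of a vertex: `y_j ↦ y_j + t_j` for all `j` -/

section YShift

variable {r : ℕ}

/-- The system `(y₁ + t₁, …, y_r + t_r, u₁, u₂)`. [cite: CossartJannsenSaito2020, Def. 8.2 (3)] [cite: CossartPiltant2008, §4 p. 11] -/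
def yShift (c : Fin (r + 2) → R) (t : Fin r → R) : Fin (r + 2) → R := c + Fin.append t ![0, 0]

/-- Components at the `y_j`. [cite: CossartJannsenSaito2020, Def. 8.2 (3)] -/
theorem yShift_y (c : Fin (r + 2) → R) (t : Fin r → R) (j : Fin r) : yShift c t (Fin.castAdd 2 j) = c (Fin.castAdd 2 j) + t j := by
  simp [yShift]

/-- Component at `u₁`. [cite: CossartJannsenSaito2020, Def. 8.2 (3)] -/
theorem yShift_u1 (c : Fin (r + 2) → R) (t : Fin r → R) : yShift c t (u1 r) = c (u1 r) := by
  simp [yShift, u1]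

/-- Component at `u₂`. [cite: CossartJannsenSaito2020, Def. 8.2 (3)] -/
theorem yShift_u2 (c : Fin (r + 2) → R) (t : Fin r → R) : yShift c t (u2 r) = c (u2 r) := by
  simp [yShift, u2]

/-- Undoing the shift. [cite: CossartJannsenSaito2020, Def. 8.2 (3)] -/
theorem yShift_yShift_neg (c : Fin (r + 2) → R) (t : Fin r → R) : yShift (yShift c t) (-t) = c := by
  funext i
  simp only [yShift, Pi.add_apply]
  refine Fin.addCases (fun j => ?_) (fun j => ?_) i
  · simp
  · fin_cases j <;> simp

/-- The shift monomial `λ u₁^a u₂^b`. [cite: CossartJannsenSaito2020, Def. 8.2 (3)] [cite: CossartPiltant2008, §4 p. 11] -/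
def uMonom (c : Fin (r + 2) → R) (lam : R) (a b : ℕ) : R := lam * (c (u1 r) ^ a * c (u2 r) ^ b)

/-- The shift monomial does not see the shift. [cite: CossartJannsenSaito2020, Def. 8.2 (3)] -/
theorem uMonom_yShift (c : Fin (r + 2) → R) (t : Fin r → R) (lam : R) (a b : ℕ) : uMonom (yShift c t) lam a b = uMonom c lam a b := by
  rw [uMonom, uMonom, yShift_u1, yShift_u2]

/-- `a w_{u₁} + b w_{u₂} ≥ ρ ⇒ λ u₁^a u₂^b ∈ F_ρ`. [cite: CossartJannsenSaito2020, Def. 7.2 (1)] -/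
theorem uMonom_mem_weightedOrderIdeal (c : Fin (r + 2) → R) (w : Fin (r + 2) → ℕ) (lam : R) {a b ρ : ℕ}
    (h : ρ ≤ a * w (u1 r) + b * w (u2 r)) : uMonom c lam a b ∈ weightedOrderIdeal c w ρ := by
  refine Ideal.mul_mem_left _ _ (weightedOrderIdeal_antitone c w h ?_)
  have h1 : c (u1 r) ^ a ∈ weightedOrderIdeal c w (a * w (u1 r)) :=
    weightedOrderIdeal_pow_le c w _ _ (Ideal.pow_mem_pow (apply_mem_weightedOrderIdeal c w (u1 r)) _)
  have h2 : c (u2 r) ^ b ∈ weightedOrderIdeal c w (b * w (u2 r)) :=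
    weightedOrderIdeal_pow_le c w _ _ (Ideal.pow_mem_pow (apply_mem_weightedOrderIdeal c w (u2 r)) _)
  exact weightedOrderIdeal_mul_le c w _ _ (Ideal.mul_mem_mul h1 h2)

/-- **`F_ρ(y + t, u) = F_ρ(y, u)`** when each `t_j` has weight `≥ w_{y_j}` with respect to both systems.
[cite: CossartJannsenSaito2020, Thm. 8.16] [cite: CossartPiltant2008, §4 p. 11] -/
theorem weightedOrderIdeal_yShift (c : Fin (r + 2) → R) (t : Fin r → R) (w : Fin (r + 2) → ℕ)
    (ht : ∀ j, t j ∈ weightedOrderIdeal c w (w (Fin.castAdd 2 j))) (ht' : ∀ j, t j ∈ weightedOrderIdeal (yShift c t) w (w (Fin.castAdd 2 j)))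
    (ρ : ℕ) : weightedOrderIdeal (yShift c t) w ρ = weightedOrderIdeal c w ρ := by
  refine weightedOrderIdeal_eq_of_forall_apply_mem c (yShift c t) w (fun i => ?_) (fun i => ?_) ρ
  · refine Fin.addCases (fun j => ?_) (fun j => ?_) i
    · rw [yShift_y]; exact Ideal.add_mem _ (apply_mem_weightedOrderIdeal c w _) (ht j)
    · fin_cases j
      · exact (yShift_u1 c t) ▸ apply_mem_weightedOrderIdeal c w (u1 r)
      · exact (yShift_u2 c t) ▸ apply_mem_weightedOrderIdeal c w (u2 r)
  · refine Fin.addCases (fun j => ?_) (fun j => ?_) i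
    · have : c (Fin.castAdd 2 j) = yShift c t (Fin.castAdd 2 j) - t j := by rw [yShift_y]; ring
      rw [this]; exact Ideal.sub_mem _ (apply_mem_weightedOrderIdeal _ w _) (ht' j)
    · fin_cases j
      · exact (yShift_u1 c t).symm ▸ apply_mem_weightedOrderIdeal (yShift c t) w (u1 r)
      · exact (yShift_u2 c t).symm ▸ apply_mem_weightedOrderIdeal (yShift c t) w (u2 r)

/-- **Dissolution by `u`-monomials does not change the weighted order ideals on or above the supporting line**: for `t_j = λ_j u₁^a u₂^b` with
`a w_{u₁} + b w_{u₂} ≥ w_{y_j}` for all `j`, `F_ρ(y + t, u) = F_ρ(y, u)`. [cite: CossartJannsenSaito2020, Thm. 8.16] [cite: CossartPiltant2008, §4 p. 11] -/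
theorem weightedOrderIdeal_yShift_uMonom (c : Fin (r + 2) → R) (lam : Fin r → R) {a b : ℕ} (w : Fin (r + 2) → ℕ)
    (h : ∀ j, w (Fin.castAdd 2 j) ≤ a * w (u1 r) + b * w (u2 r)) (ρ : ℕ) :
    weightedOrderIdeal (yShift c fun j => uMonom c (lam j) a b) w ρ = weightedOrderIdeal c w ρ := by
  refine weightedOrderIdeal_yShift c _ w (fun j => uMonom_mem_weightedOrderIdeal c w (lam j) (h j)) (fun j => ?_) ρ
  rw [← uMonom_yShift c (fun j => uMonom c (lam j) a b) (lam j) a b]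
  exact uMonom_mem_weightedOrderIdeal _ w (lam j) (h j)

/-- **`(y + t, u)` generates `𝔪` when `(y, u)` does and the `t_j` lie in `(u₁, u₂)`.** [cite: CossartJannsenSaito2020, Def. 8.2 (3)] -/
theorem span_range_yShift (c : Fin (r + 2) → R) (t : Fin r → R) (ht : ∀ j, t j ∈ Ideal.span {c (u1 r), c (u2 r)}) :
    Ideal.span (Set.range (yShift c t)) = Ideal.span (Set.range c) := by
  have key : ∀ (c : Fin (r + 2) → R) (t : Fin r → R), (∀ j, t j ∈ Ideal.span {c (u1 r), c (u2 r)}) →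
      Ideal.span (Set.range c) ≤ Ideal.span (Set.range (yShift c t)) := by
    intro c t ht
    have hu1 : c (u1 r) ∈ Ideal.span (Set.range (yShift c t)) := (yShift_u1 c t) ▸ Ideal.subset_span ⟨u1 r, rfl⟩
    have hu2 : c (u2 r) ∈ Ideal.span (Set.range (yShift c t)) := (yShift_u2 c t) ▸ Ideal.subset_span ⟨u2 r, rfl⟩
    have hu : Ideal.span {c (u1 r), c (u2 r)} ≤ Ideal.span (Set.range (yShift c t)) := by
      rw [Ideal.span_le]
      rintro x hx
      rcases hx with rfl | rfl
      · exact hu1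
      · exact hu2
    rw [Ideal.span_le]
    rintro _ ⟨i, rfl⟩
    refine Fin.addCases (fun j => ?_) (fun j => ?_) i
    · have : c (Fin.castAdd 2 j) = yShift c t (Fin.castAdd 2 j) - t j := by rw [yShift_y]; ring
      rw [SetLike.mem_coe, this]
      exact Ideal.sub_mem _ (Ideal.subset_span ⟨_, rfl⟩) (hu (ht j))
    · fin_cases j
      · exact hu1
      · exact hu2
  refine le_antisymm ?_ (key c t ht)
  have h := key (yShift c t) (-t) (fun j => by rw [yShift_u1, yShift_u2]; exact Submodule.neg_mem _ (ht j))
  rwa [yShift_yShift_neg] at h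

end YShift

/-! ## The shear `u₂ ↦ u₂ + λ u₁` -/

section Shear

variable {r : ℕ}

/-- The system `(y, u₁, u₂ + λ u₁)`. [cite: CossartJannsenSaito2020, Lemma 13.6] [cite: CossartPiltant2008, Lemma 4.5 (proof, p. 12)] -/
def u2Shear (c : Fin (r + 2) → R) (lam : R) : Fin (r + 2) → R := Function.update c (u2 r) (c (u2 r) + lam * c (u1 r))

/-- Component at `u₂`. [cite: CossartJannsenSaito2020, Lemma 13.6] -/
theorem u2Shear_u2 (c : Fin (r + 2) → R) (lam : R) : u2Shear c lam (u2 r) = c (u2 r) + lam * c (u1 r) := by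
  simp [u2Shear]

/-- Components away from `u₂`. [cite: CossartJannsenSaito2020, Lemma 13.6] -/
theorem u2Shear_of_ne (c : Fin (r + 2) → R) (lam : R) {i : Fin (r + 2)} (h : i ≠ u2 r) : u2Shear c lam i = c i := by
  simp [u2Shear, h]

/-- Component at `u₁`. [cite: CossartJannsenSaito2020, Lemma 13.6] -/
theorem u2Shear_u1 (c : Fin (r + 2) → R) (lam : R) : u2Shear c lam (u1 r) = c (u1 r) :=
  u2Shear_of_ne c lam (fun h => by have := congrArg Fin.val h; simp [u1, u2, Fin.natAdd] at this)

/-- Undoing the shear. [cite: CossartJannsenSaito2020, Lemma 13.6] -/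
theorem u2Shear_u2Shear_neg (c : Fin (r + 2) → R) (lam : R) : u2Shear (u2Shear c lam) (-lam) = c := by
  funext i
  by_cases h : i = u2 r
  · subst h; rw [u2Shear_u2, u2Shear_u2, u2Shear_u1]; ring
  · rw [u2Shear_of_ne _ _ h, u2Shear_of_ne _ _ h]

/-- **The shear `u₂ ↦ u₂ + λ u₁` does not change `F_ρ` when `w_{u₂} ≤ w_{u₁}`** (supporting lines at least as steep as the diagonal).
[cite: CossartJannsenSaito2020, Lemma 13.6] [cite: CossartPiltant2008, Lemma 4.5 (proof, p. 12)] -/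
theorem weightedOrderIdeal_u2Shear (c : Fin (r + 2) → R) (lam : R) (w : Fin (r + 2) → ℕ) (hw : w (u2 r) ≤ w (u1 r)) (ρ : ℕ) :
    weightedOrderIdeal (u2Shear c lam) w ρ = weightedOrderIdeal c w ρ := by
  have key : ∀ (c : Fin (r + 2) → R) (lam : R) (i : Fin (r + 2)), u2Shear c lam i ∈ weightedOrderIdeal c w (w i) := by
    intro c lam i
    by_cases h : i = u2 r
    · subst h
      rw [u2Shear_u2]
      exact Ideal.add_mem _ (apply_mem_weightedOrderIdeal c w _)
        (Ideal.mul_mem_left _ _ (weightedOrderIdeal_antitone c w hw (apply_mem_weightedOrderIdeal c w (u1 r))))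
    · rw [u2Shear_of_ne c lam h]; exact apply_mem_weightedOrderIdeal c w i
  refine weightedOrderIdeal_eq_of_forall_apply_mem c (u2Shear c lam) w (key c lam) (fun i => ?_) ρ
  have h := key (u2Shear c lam) (-lam) i
  rwa [u2Shear_u2Shear_neg] at h

/-- **`(y, u₁, u₂ + λ u₁)` generates the same ideal as `(y, u₁, u₂)`.** [cite: CossartJannsenSaito2020, Lemma 13.6] -/
theorem span_range_u2Shear (c : Fin (r + 2) → R) (lam : R) : Ideal.span (Set.range (u2Shear c lam)) = Ideal.span (Set.range c) := by
  have key : ∀ (c : Fin (r + 2) → R) (lam : R), Ideal.span (Set.range (u2Shear c lam)) ≤ Ideal.span (Set.range c) := by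
    intro c lam
    rw [Ideal.span_le]
    rintro _ ⟨i, rfl⟩
    by_cases h : i = u2 r
    · subst h
      rw [SetLike.mem_coe, u2Shear_u2]
      exact Ideal.add_mem _ (Ideal.subset_span ⟨_, rfl⟩) (Ideal.mul_mem_left _ _ (Ideal.subset_span ⟨_, rfl⟩))
    · rw [SetLike.mem_coe, u2Shear_of_ne c lam h]; exact Ideal.subset_span ⟨i, rfl⟩
  refine le_antisymm (key c lam) ?_
  have h := key (u2Shear c lam) (-lam)
  rwa [u2Shear_u2Shear_neg] at h

end Shear

end WeightedOrder

end Literature.AlgebraicGeometry.Resolution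

end
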